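import Summits.AtomisticToContinuum.BoseEinsteinCondensation.Theorems.BlockLatticeFSumBoxModesVanish
import Summits.AtomisticToContinuum.BoseEinsteinCondensation.Theorems.BoxLatticeFSumCarving

/-!
# MF «BoxMixedFloor» — the tail: from two F♭-shift instances and a cell-energy budget to the discounted mixed floor (decomp-a2c hand-2 g8)

Given the conclusions of `dirichletBudgetBlockFloor_shift` for the block constants `2A` and `A`, a Dirichlet near-minimiser `Ψ` of the box of
side `L = (N/ρ)^{1/3}` whose energy obeys the plain budget `(4πa + τ)(N/L'³)N` for every cell side `L'` with `c₁ρ ≤ N/L'³ ≤ ρ`, an even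
block number `K ≥ K₀ ≥ 48` (`c₁ ≤ 1 − 12/K`) with `L/K` in the GP window `[A, 2A]/√ρ`, and a shift class `s ∈ {0,1}³`:
`∑_{m : SubIdx (K/2+1)} n(pieceMode L K s m) ≥ (1−η)N` (`mixedFloor_tail`).  Mechanism: translate by `(L/K)s`, zero-extend to the cell of
`K' = K/2+1` (if even) or `K/2+2` super-blocks of side `2L/K`, apply the instance whose window contains `2L/K` at the density `N/L'³`
(`ρ/4 ≤ N/L'³ ≤ ρ`), and drop the empty last layer (`BlockLatticeFSumBoxModesVanish`).  `[folklore]`; no definitions, no `sorry`.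
-/

noncomputable section

open MeasureTheory Set Filter
open scoped ENNReal NNReal BigOperators

namespace Summit.AtomisticToContinuum.BoseEinsteinCondensation.Theorems.BlockLatticeFSumMixedFloorTail

open Literature.MathematicalPhysics.QuantumManyBody.BoseGas
open Summit.AtomisticToContinuum.BoseEinsteinCondensation.Theorems.BoxLatticeFSum (InWindow pieceMode blockShift)
open Summit.AtomisticToContinuum.BoseEinsteinCondensation.Theorems.BlockLatticeFSumBoxModesVanish
  (subMode_castSucc occupation_shiftMode_eq_zero sum_subIdx_succ_eq_of_last_zero)

/-- Coordinates of the shift vector `(L/K)·s`. [folklore] -/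
theorem blockShift_apply (L : ℝ) (K : ℕ) (s : Fin 3 → Fin 2) (i : Fin 3) :
    blockShift L K s i = L / (K : ℝ) * (((s i : Fin 2) : ℕ) : ℝ) := rfl

set_option maxHeartbeats 1600000 in
/-- **The tail of MF.**  See the module docstring. [cite: LSSY2005, Thm. 5.1 (5.15)–(5.17); folklore (translation, zero extension)] -/
theorem mixedFloor_tail {v : ℝ → ℝ≥0∞} {A η τ ρ₁ ρ₂ τ₁ τ₂ c₁ ρ : ℝ} {N₁ N₂ K₀ N K : ℕ} (hA : 0 < A)
    (H₁ : (∀ (N : ℕ) (L L' : ℝ) (a : Space), 0 < L' →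
        (∀ k, 0 ≤ a k) → (∀ k, a k + L ≤ L') → N₁ ≤ N →
        (N : ℝ) ≤ ρ₁ * L' ^ 3 → ∀ Ψ : TrialState N L,
          energy v Ψ ≤ ENNReal.ofReal ((4 * Real.pi * (scatteringLength v).toReal + τ₁) * ((N : ℝ) / L' ^ 3) * N) →
          ∀ K : ℕ, Even K → 0 < K →
            (2 * A) / Real.sqrt ((N : ℝ) / L' ^ 3) ≤ L' / (K : ℝ) ∧ L' / (K : ℝ) ≤ 2 * (2 * A) / Real.sqrt ((N : ℝ) / L' ^ 3) →
            ENNReal.ofReal ((1 - η) * N) ≤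
              ∑ q : SubIdx K, occupation N (fun x => subMode (L' / (K : ℝ)) q (x + a)) Ψ.ψ))
    (H₂ : (∀ (N : ℕ) (L L' : ℝ) (a : Space), 0 < L' →
        (∀ k, 0 ≤ a k) → (∀ k, a k + L ≤ L') → N₂ ≤ N →
        (N : ℝ) ≤ ρ₂ * L' ^ 3 → ∀ Ψ : TrialState N L,
          energy v Ψ ≤ ENNReal.ofReal ((4 * Real.pi * (scatteringLength v).toReal + τ₂) * ((N : ℝ) / L' ^ 3) * N) →
          ∀ K : ℕ, Even K → 0 < K →
            A / Real.sqrt ((N : ℝ) / L' ^ 3) ≤ L' / (K : ℝ) ∧ L' / (K : ℝ) ≤ 2 * A / Real.sqrt ((N : ℝ) / L' ^ 3) →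
            ENNReal.ofReal ((1 - η) * N) ≤
              ∑ q : SubIdx K, occupation N (fun x => subMode (L' / (K : ℝ)) q (x + a)) Ψ.ψ))
    (hτ1 : τ ≤ τ₁) (hτ2 : τ ≤ τ₂) (hρ : 0 < ρ) (hρ1 : ρ ≤ ρ₁) (hρ2 : ρ ≤ ρ₂)
    (hN1 : N₁ ≤ N) (hN2 : N₂ ≤ N) (hNpos : 0 < N) (Ψ : TrialState N (sideLength ρ N))
    (hbud : ∀ L' : ℝ, 0 < L' → c₁ * ρ ≤ (N : ℝ) / L' ^ 3 → (N : ℝ) / L' ^ 3 ≤ ρ →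
      energy v Ψ ≤ ENNReal.ofReal ((4 * Real.pi * (scatteringLength v).toReal + τ) * ((N : ℝ) / L' ^ 3) * N))
    (hK : Even K) (hK₀ : 48 ≤ K₀) (hKK₀ : K₀ ≤ K) (hc₁ : c₁ = 1 - 12 / (K₀ : ℝ))
    (hwin : InWindow A ρ (sideLength ρ N) K) (s : Fin 3 → Fin 2) :
    ENNReal.ofReal ((1 - η) * N) ≤
      ∑ m : SubIdx (K / 2 + 1), occupation N (pieceMode (sideLength ρ N) K s m) Ψ.ψ := by
  -- scales: name the side `L` (generalised consistently in `Ψ`, `hbud`, `hwin` and the goal)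
  have hL : 0 < sideLength ρ N := sideLength_pos_of_pos hρ hNpos
  have hL3 : sideLength ρ N ^ 3 = (N : ℝ) / ρ := sideLength_pow_three hρ N
  generalize sideLength ρ N = L at hL hL3 Ψ hbud hwin ⊢
  have hNr : (0 : ℝ) < N := by exact_mod_cast hNpos
  have hKr48 : (48 : ℝ) ≤ K := by exact_mod_cast hK₀.trans hKK₀
  have hKr : (0 : ℝ) < K := by linarith
  have hK2 : (K / 2) * 2 = K := Nat.div_mul_cancel (even_iff_two_dvd.1 hK)
  have hK2r : ((K / 2 : ℕ) : ℝ) * 2 = K := by exact_mod_cast hK2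
  obtain ⟨b, hbdef⟩ : ∃ b : ℝ, b = 2 * (L / (K : ℝ)) := ⟨_, rfl⟩
  have hb : 0 < b := by rw [hbdef]; positivity
  -- the window for the block side `b = 2L/K`: `2A/√ρ ≤ b ≤ 4A/√ρ`
  have hsρ : 0 < Real.sqrt ρ := Real.sqrt_pos.2 hρ
  obtain ⟨hw1, hw2⟩ := hwin
  have hbw1 : 2 * A / Real.sqrt ρ ≤ b := by
    rw [hbdef, show 2 * A / Real.sqrt ρ = 2 * (A / Real.sqrt ρ) by ring]; linarith
  have hbw2 : b ≤ 4 * A / Real.sqrt ρ := by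
    rw [hbdef]; have := hw2; rw [show 4 * A / Real.sqrt ρ = 2 * (2 * A / Real.sqrt ρ) by ring]; linarith
  -- the shift
  obtain ⟨av, havdef⟩ : ∃ av : Space, av = blockShift L K s := ⟨_, rfl⟩
  have ha0 : ∀ k, 0 ≤ av k := fun k => by
    rw [havdef, blockShift_apply]; positivity
  have ha1 : ∀ k, av k ≤ L / (K : ℝ) := fun k => by
    rw [havdef, blockShift_apply]
    have hs1 : (((s k : Fin 2) : ℕ) : ℝ) ≤ 1 := by exact_mod_cast Nat.lt_succ_iff.1 (s k).isLt
    have : 0 ≤ L / (K : ℝ) := by positivity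
    nlinarith
  -- the number of super-blocks: `K' = K/2 + 1` or `K/2 + 2`, even, and the larger cell `L' = K'·b`
  -- common estimates for a cell side `L'` with `L + L/K ≤ L' ≤ L + 4L/K`
  have hcell : ∀ L' : ℝ, L + L / (K : ℝ) ≤ L' → L' ≤ L + 4 * (L / (K : ℝ)) →
      0 < L' ∧ (∀ k, av k + L ≤ L') ∧ (N : ℝ) / L' ^ 3 ≤ ρ ∧ c₁ * ρ ≤ (N : ℝ) / L' ^ 3 ∧ ρ ≤ 4 * ((N : ℝ) / L' ^ 3) := by
    intro L' h1 h2
    have hLK0 : 0 ≤ L / (K : ℝ) := by positivity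
    have hL' : 0 < L' := by linarith
    have hLL' : L ≤ L' := by linarith
    refine ⟨hL', fun k => by linarith [ha1 k], ?_, ?_, ?_⟩
    · -- `N/L'³ ≤ N/L³ = ρ`
      rw [div_le_iff₀ (by positivity)]
      have h3 : L ^ 3 ≤ L' ^ 3 := pow_le_pow_left₀ hL.le hLL' 3
      have : (N : ℝ) = ρ * L ^ 3 := by rw [hL3]; field_simp
      nlinarith
    · -- `c₁ ρ ≤ N/L'³`: `L'³ (1 − 12/K₀) ≤ L³` since `L' ≤ L(1 + 4/K)` and `(1+4/K)³(1−12/K) ≤ 1`, `K ≥ K₀`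
      rw [le_div_iff₀ (by positivity), hc₁]
      have hK₀r : (48 : ℝ) ≤ K₀ := by exact_mod_cast hK₀
      have hK₀K : (K₀ : ℝ) ≤ K := by exact_mod_cast hKK₀
      have hu : 0 < 4 / (K : ℝ) := by positivity
      have hu1 : 4 / (K : ℝ) ≤ 1 / 12 := by rw [div_le_div_iff₀ hKr (by norm_num)]; linarith
      set u : ℝ := 4 / (K : ℝ) with hu_def
      have hL'u : L' ≤ L * (1 + u) := by
        rw [hu_def]
        have : L + 4 * (L / (K : ℝ)) = L * (1 + 4 / K) := by field_simp
        linarith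
      have h12 : 1 - 12 / (K₀ : ℝ) ≤ 1 - 3 * u := by
        rw [hu_def]
        have h12' : 12 / (K : ℝ) ≤ 12 / K₀ := div_le_div_of_nonneg_left (by norm_num) (by positivity) hK₀K
        have h3 : 3 * (4 / (K : ℝ)) = 12 / K := by ring
        linarith
      have hpos13 : 0 ≤ 1 - 3 * u := by linarith
      have hcube : L' ^ 3 ≤ (L * (1 + u)) ^ 3 := pow_le_pow_left₀ hL'.le hL'u 3
      have hber : (1 + u) ^ 3 * (1 - 3 * u) ≤ 1 := by
        have hexp : (1 + u) ^ 3 * (1 - 3 * u) = 1 - 6 * u ^ 2 - 8 * u ^ 3 - 3 * u ^ 4 := by ring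
        rw [hexp]
        have h2 := pow_pos hu 2
        have h3 := pow_pos hu 3
        have h4 := pow_pos hu 4
        linarith
      have hN : (N : ℝ) = ρ * L ^ 3 := by rw [hL3]; field_simp
      calc (1 - 12 / (K₀ : ℝ)) * ρ * L' ^ 3 = (1 - 12 / (K₀ : ℝ)) * (ρ * L' ^ 3) := by ring
        _ ≤ (1 - 3 * u) * (ρ * L' ^ 3) := mul_le_mul_of_nonneg_right h12 (by positivity)
        _ ≤ (1 - 3 * u) * (ρ * (L * (1 + u)) ^ 3) :=
            mul_le_mul_of_nonneg_left (mul_le_mul_of_nonneg_left hcube hρ.le) hpos13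
        _ = ρ * L ^ 3 * ((1 + u) ^ 3 * (1 - 3 * u)) := by ring
        _ ≤ ρ * L ^ 3 * 1 := mul_le_mul_of_nonneg_left hber (by positivity)
        _ = N := by rw [hN]; ring
    · -- `ρ ≤ 4 N/L'³`: `L'³ ≤ 4 L³` since `L' ≤ (1 + 1/12) L`
      rw [show 4 * ((N : ℝ) / L' ^ 3) = 4 * N / L' ^ 3 by ring, le_div_iff₀ (by positivity)]
      have hL'2 : L' ≤ L * (13 / 12) := by
        have : 4 * (L / (K : ℝ)) ≤ L / 12 := by
          rw [show 4 * (L / (K : ℝ)) = L * (4 / K) by ring, show L / 12 = L * (1 / 12) by ring]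
          exact mul_le_mul_of_nonneg_left (by rw [div_le_div_iff₀ hKr (by norm_num)]; linarith) hL.le
        linarith
      have hcube : L' ^ 3 ≤ (L * (13 / 12)) ^ 3 := pow_le_pow_left₀ hL'.le hL'2 3
      have hN : (N : ℝ) = ρ * L ^ 3 := by rw [hL3]; field_simp
      rw [hN]
      calc ρ * L' ^ 3 ≤ ρ * (L * (13 / 12)) ^ 3 := mul_le_mul_of_nonneg_left hcube hρ.le
        _ = (2197 / 1728) * (ρ * L ^ 3) := by ring
        _ ≤ 4 * (ρ * L ^ 3) := mul_le_mul_of_nonneg_right (by norm_num) (by positivity)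
  -- apply the instances at a given even `K'` with `L' = K'·b` in the admissible range
  have happly : ∀ K' : ℕ, Even K' → 0 < K' → L + L / (K : ℝ) ≤ (K' : ℝ) * b → (K' : ℝ) * b ≤ L + 4 * (L / (K : ℝ)) →
      ENNReal.ofReal ((1 - η) * N) ≤
        ∑ q : SubIdx K', occupation N (fun x => subMode b q (x + av)) Ψ.ψ := by
    intro K' hK'e hK'0 h1 h2
    obtain ⟨L', hL'def⟩ : ∃ L' : ℝ, L' = (K' : ℝ) * b := ⟨_, rfl⟩
    rw [← hL'def] at h1 h2
    obtain ⟨hL', haL, hρ'le, hρ'ge, hρ'4⟩ := hcell L' h1 h2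
    have hK'r : (0 : ℝ) < K' := by exact_mod_cast hK'0
    have hbK : L' / (K' : ℝ) = b := by rw [hL'def]; field_simp
    obtain ⟨ρ', hρ'def⟩ : ∃ ρ' : ℝ, ρ' = (N : ℝ) / L' ^ 3 := ⟨_, rfl⟩
    rw [← hρ'def] at hρ'le hρ'ge hρ'4
    have hρ'0 : 0 < ρ' := by rw [hρ'def]; positivity
    have hsρ' : 0 < Real.sqrt ρ' := Real.sqrt_pos.2 hρ'0
    -- `1/√ρ ≤ 1/√ρ' ≤ 2/√ρ`
    have hsq1 : Real.sqrt ρ' ≤ Real.sqrt ρ := Real.sqrt_le_sqrt hρ'le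
    have hsq2 : Real.sqrt ρ ≤ 2 * Real.sqrt ρ' := by
      rw [show 2 * Real.sqrt ρ' = Real.sqrt (2 ^ 2 * ρ') by rw [Real.sqrt_mul (by norm_num), Real.sqrt_sq (by norm_num)]]
      exact Real.sqrt_le_sqrt (by linarith)
    -- density and budget premises of the instances
    have hNL' : (N : ℝ) = ρ' * L' ^ 3 := by rw [hρ'def]; field_simp
    have hNρ1 : (N : ℝ) ≤ ρ₁ * L' ^ 3 := by
      rw [hNL']; exact mul_le_mul_of_nonneg_right (hρ'le.trans hρ1) (by positivity)
    have hNρ2 : (N : ℝ) ≤ ρ₂ * L' ^ 3 := by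
      rw [hNL']; exact mul_le_mul_of_nonneg_right (hρ'le.trans hρ2) (by positivity)
    have hE := hbud L' hL' (by rw [← hρ'def]; exact hρ'ge) (by rw [← hρ'def]; exact hρ'le)
    have hEi : ∀ τ' : ℝ, τ ≤ τ' → energy v Ψ ≤
        ENNReal.ofReal ((4 * Real.pi * (scatteringLength v).toReal + τ') * ((N : ℝ) / L' ^ 3) * N) := by
      intro τ' hτ'
      refine hE.trans (ENNReal.ofReal_le_ofReal ?_)
      have : 0 ≤ ((N : ℝ) / L' ^ 3) * N := by positivity
      nlinarith
    by_cases hcase : 2 * A / Real.sqrt ρ' ≤ b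
    · -- instance `2A`
      have hup : b ≤ 2 * (2 * A) / Real.sqrt ρ' := by
        calc b ≤ 4 * A / Real.sqrt ρ := hbw2
          _ ≤ 4 * A / Real.sqrt ρ' := div_le_div_of_nonneg_left (by positivity) hsρ' hsq1
          _ = 2 * (2 * A) / Real.sqrt ρ' := by ring
      have hw' : 2 * A / Real.sqrt ((N : ℝ) / L' ^ 3) ≤ L' / (K' : ℝ) ∧
          L' / (K' : ℝ) ≤ 2 * (2 * A) / Real.sqrt ((N : ℝ) / L' ^ 3) := by
        rw [hbK, ← hρ'def]; exact ⟨hcase, hup⟩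
      have h := H₁ N L L' av hL' ha0 haL hN1 hNρ1 Ψ (hEi τ₁ hτ1) K' hK'e hK'0 hw'
      rw [hbK] at h
      exact h
    · -- instance `A`
      have hlo : A / Real.sqrt ρ' ≤ b := by
        calc A / Real.sqrt ρ' ≤ A * 2 / Real.sqrt ρ := by
              rw [div_le_div_iff₀ hsρ' hsρ]
              have := mul_le_mul_of_nonneg_left hsq2 hA.le
              linarith
          _ = 2 * A / Real.sqrt ρ := by ring
          _ ≤ b := hbw1
      have hup : b ≤ 2 * A / Real.sqrt ρ' := (not_le.1 hcase).le
      have hw' : A / Real.sqrt ((N : ℝ) / L' ^ 3) ≤ L' / (K' : ℝ) ∧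
          L' / (K' : ℝ) ≤ 2 * A / Real.sqrt ((N : ℝ) / L' ^ 3) := by
        rw [hbK, ← hρ'def]; exact ⟨hlo, hup⟩
      have h := H₂ N L L' av hL' ha0 haL hN2 hNρ2 Ψ (hEi τ₂ hτ2) K' hK'e hK'0 hw'
      rw [hbK] at h
      exact h
  -- the two parity cases of `K/2`
  have hsum_ge : L + L / (K : ℝ) ≤ ((K / 2 + 1 : ℕ) : ℝ) * b ∧ ((K / 2 + 1 : ℕ) : ℝ) * b ≤ L + 4 * (L / (K : ℝ)) := by
    have : ((K / 2 + 1 : ℕ) : ℝ) * b = L + 2 * (L / (K : ℝ)) := by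
      push_cast; rw [hbdef]
      have : ((K / 2 : ℕ) : ℝ) * (2 * (L / K)) = L := by
        rw [show ((K / 2 : ℕ) : ℝ) * (2 * (L / K)) = (((K / 2 : ℕ) : ℝ) * 2) * L / K by ring, hK2r]; field_simp
      linarith
    have h0 : 0 ≤ L / (K : ℝ) := by positivity
    constructor <;> linarith
  have hsum_ge2 : L + L / (K : ℝ) ≤ ((K / 2 + 1 + 1 : ℕ) : ℝ) * b ∧ ((K / 2 + 1 + 1 : ℕ) : ℝ) * b ≤ L + 4 * (L / (K : ℝ)) := by
    have : ((K / 2 + 1 + 1 : ℕ) : ℝ) * b = L + 4 * (L / (K : ℝ)) := by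
      push_cast; rw [hbdef]
      have : ((K / 2 : ℕ) : ℝ) * (2 * (L / K)) = L := by
        rw [show ((K / 2 : ℕ) : ℝ) * (2 * (L / K)) = (((K / 2 : ℕ) : ℝ) * 2) * L / K by ring, hK2r]; field_simp
      linarith
    have h0 : 0 ≤ L / (K : ℝ) := by positivity
    constructor <;> linarith
  -- identify the summands with `pieceMode`
  have hpiece : ∀ m : SubIdx (K / 2 + 1), pieceMode L K s m = fun x => subMode b m (x + av) := by
    intro m; funext x; rw [hbdef, havdef]; rfl
  simp only [hpiece]
  rcases Nat.even_or_odd (K / 2) with hev | hodd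
  · -- `K/2` even: use `K' = K/2 + 2` and drop the empty last layer
    have hK'e : Even (K / 2 + 1 + 1) := by
      rw [show K / 2 + 1 + 1 = K / 2 + 2 by ring]; exact hev.add even_two
    have h := happly (K / 2 + 1 + 1) hK'e (Nat.succ_pos _) hsum_ge2.1 hsum_ge2.2
    rw [sum_subIdx_succ_eq_of_last_zero _ ?_] at h
    · simpa only [subMode_castSucc] using h
    · rintro m ⟨k, hk⟩
      refine occupation_shiftMode_eq_zero Ψ b av m ⟨k, ?_⟩
      rw [hk, Fin.val_last]
      have hlast : b * ((K / 2 + 1 : ℕ) : ℝ) = L + 2 * (L / (K : ℝ)) := by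
        push_cast; rw [hbdef]
        have : ((K / 2 : ℕ) : ℝ) * (2 * (L / K)) = L := by
          rw [show ((K / 2 : ℕ) : ℝ) * (2 * (L / K)) = (((K / 2 : ℕ) : ℝ) * 2) * L / K by ring, hK2r]; field_simp
        linarith
      rw [hlast]
      linarith [ha1 k, show 0 ≤ L / (K : ℝ) by positivity]
  · -- `K/2` odd: `K' = K/2 + 1` is even
    have hK'e : Even (K / 2 + 1) := hodd.add_one
    exact happly (K / 2 + 1) hK'e (Nat.succ_pos _) hsum_ge.1 hsum_ge.2

end Summit.AtomisticToContinuum.BoseEinsteinCondensation.Theorems.BlockLatticeFSumMixedFloorTail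

end
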